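import Summits.CriticalPhenomena.PercolationContinuityZ3.Theorems.PercNearOneGluingNoHeavyLowerTailSahiOneStepFibreParamThree
import Summits.CriticalPhenomena.PercolationContinuityZ3.Theorems.PercNearOneGluingNoHeavyLowerTailSahiOneStepFibreThresholdFive
import Summits.CriticalPhenomena.PercolationContinuityZ3.Theorems.PercNearOneGluingNoHeavyLowerTailSahiOneStepFibreF3Defs
import Mathlib.Algebra.BigOperators.Group.Finset.Powerset
import HarnessLib

/-!
# One-step scheme: `(2′)` FOR A THRESHOLD SLOT REDUCES TO THE THREE-COPY FIBRE FORMS ON PAIRS OF UPPER-SET INDICATORS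

Support file (prover prim-ineq-prove-3 gen 16; `--supports stmt-CriticalPhenomena-4575`; memo
`run/shared/lean/prim/prim-ineq-prove-3/FINDING-G16-FIBRE-MAJ5.md` §2.3, §3.6, §3.8).  No definitions, no named facts, no sorries, no `native_decide`.

* `phi3_threshold_eq`: on the fibre `(I₃, I₂, J)` of `…SahiOneStepFibreParamThree`, the three-copy summand of `n` for `H = Th_t(F)` is the summand
  `f3term` (`…FibreF3Defs`) of the threshold trace `[t − |I₃| ≤ |·|]` with `u = 1_A(I₃ ∪ ·)`, `v = 1_B(I₃ ∪ ·)` — monotone nonnegative functions for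
  increasing `A, B`;
* `nonneg_of_nonneg_on_upper_indicators` (**cone lemma**): an additive, homogeneous functional depending only on the values on `P(D)` is `≥ 0` at every
  function monotone and nonnegative on `P(D)` as soon as it is `≥ 0` at the indicator of every upper family of `P(D)` (peel off `m·1_{supp}`, `m` the least
  positive value); applied in each argument of the bilinear form `f3sum` (`f3sum_nonneg_of_indicators`);
* `osN_threshold_nonneg_of_f3`: hence **`n ≥ 0` for `H = Th_t(F)` and all increasing `F`-determined `A, B` as soon as `f3sum ℝ D₁ D₂ θ 1_U 1_V ≥ 0` for all
  disjoint `D₁, D₂ ⊆ F`, all `θ` and all pairs of upper families `U, V` of `P(D₁ ∪ D₂)`** — a finite statement, discharged for `|F| ≤ 5` by the checker of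
  `…FibreF3Check*`.
-/

noncomputable section

namespace Summit.CriticalPhenomena.PercolationContinuityZ3.Theorems

namespace SahiOneStep

open MeasureTheory Finset
open Literature.Probability.Percolation (DeterminedBy determinedBy_iff determinedBy_univ)
open Literature.Probability.LatticeModels (prodBernoulli)
open Literature.Probability.Percolation.DecisionTree (ind ind_of_mem ind_of_not_mem ind_nonneg)
open scoped Classical


/-! ## Linearity and locality of the fibre form -/

section Generic
variable {κ : Type*} [DecidableEq κ]

/-- Members of `f3quads`. -/
theorem mem_f3quads {D₁ D₂ : Finset κ} {q : (Finset κ × Finset κ) × (Finset κ × Finset κ)} :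
    q ∈ f3quads D₁ D₂ ↔ (q.1.1 ⊆ D₁ ∧ q.1.2 ⊆ D₁) ∧ (q.2.1 ⊆ D₂ ∧ q.2.2 ⊆ D₂) ∧ Disjoint q.1.1 q.1.2 ∧ Disjoint q.2.1 q.2.2 := by
  simp only [f3quads, Finset.mem_filter, Finset.mem_product, Finset.mem_powerset, and_assoc]

/-- The copies lie in `D₁ ∪ D₂`. -/
theorem f3S0_subset {D₁ D₂ : Finset κ} {q : (Finset κ × Finset κ) × (Finset κ × Finset κ)} (hq : q ∈ f3quads D₁ D₂) :
    f3S0 D₂ q ⊆ D₁ ∪ D₂ := by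
  rw [mem_f3quads] at hq
  intro i hi
  simp only [f3S0, Finset.mem_union, Finset.mem_sdiff] at hi
  rcases hi with ⟨h, _⟩ | h
  · exact Finset.mem_union_right _ h
  · exact Finset.mem_union_left _ (hq.1.1 h)

/-- The copies lie in `D₁ ∪ D₂`. -/
theorem f3S1_subset {D₁ D₂ : Finset κ} {q : (Finset κ × Finset κ) × (Finset κ × Finset κ)} (hq : q ∈ f3quads D₁ D₂) :
    f3S1 D₂ q ⊆ D₁ ∪ D₂ := by
  rw [mem_f3quads] at hq
  intro i hi
  simp only [f3S1, Finset.mem_union, Finset.mem_sdiff] at hi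
  rcases hi with ⟨h, _⟩ | h
  · exact Finset.mem_union_right _ h
  · exact Finset.mem_union_left _ (hq.1.2 h)

/-- The copies lie in `D₁ ∪ D₂`. -/
theorem f3S2_subset {D₁ D₂ : Finset κ} {q : (Finset κ × Finset κ) × (Finset κ × Finset κ)} (hq : q ∈ f3quads D₁ D₂) :
    f3S2 D₁ q ⊆ D₁ ∪ D₂ := by
  rw [mem_f3quads] at hq
  intro i hi
  simp only [f3S2, Finset.mem_union, Finset.mem_sdiff] at hi
  rcases hi with (h | h) | ⟨h, _⟩
  · exact Finset.mem_union_right _ (hq.2.1.1 h)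
  · exact Finset.mem_union_right _ (hq.2.1.2 h)
  · exact Finset.mem_union_left _ h

variable {R : Type*} [CommRing R]

/-- `f3sum` is additive in `u`. -/
theorem f3sum_add_left (D₁ D₂ : Finset κ) (θ : ℕ) (u u' v : Finset κ → R) :
    f3sum R D₁ D₂ θ (u + u') v = f3sum R D₁ D₂ θ u v + f3sum R D₁ D₂ θ u' v := by
  unfold f3sum
  rw [← Finset.sum_add_distrib]
  refine Finset.sum_congr rfl fun q _ => ?_
  simp only [f3term, Pi.add_apply]
  ring

/-- `f3sum` is homogeneous in `u`. -/
theorem f3sum_smul_left (D₁ D₂ : Finset κ) (θ : ℕ) (c : R) (u v : Finset κ → R) :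
    f3sum R D₁ D₂ θ (c • u) v = c * f3sum R D₁ D₂ θ u v := by
  unfold f3sum
  rw [Finset.mul_sum]
  refine Finset.sum_congr rfl fun q _ => ?_
  simp only [f3term, Pi.smul_apply, smul_eq_mul]
  ring

/-- `f3sum` is additive in `v`. -/
theorem f3sum_add_right (D₁ D₂ : Finset κ) (θ : ℕ) (u v v' : Finset κ → R) :
    f3sum R D₁ D₂ θ u (v + v') = f3sum R D₁ D₂ θ u v + f3sum R D₁ D₂ θ u v' := by
  unfold f3sum
  rw [← Finset.sum_add_distrib]
  refine Finset.sum_congr rfl fun q _ => ?_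
  simp only [f3term, Pi.add_apply]
  ring

/-- `f3sum` is homogeneous in `v`. -/
theorem f3sum_smul_right (D₁ D₂ : Finset κ) (θ : ℕ) (c : R) (u v : Finset κ → R) :
    f3sum R D₁ D₂ θ u (c • v) = c * f3sum R D₁ D₂ θ u v := by
  unfold f3sum
  rw [Finset.mul_sum]
  refine Finset.sum_congr rfl fun q _ => ?_
  simp only [f3term, Pi.smul_apply, smul_eq_mul]
  ring

/-- `f3sum` depends on `u` only through its values on `P(D₁ ∪ D₂)`. -/
theorem f3sum_congr_left (D₁ D₂ : Finset κ) (θ : ℕ) {u u' : Finset κ → R} (v : Finset κ → R)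
    (h : ∀ S ∈ (D₁ ∪ D₂).powerset, u S = u' S) : f3sum R D₁ D₂ θ u v = f3sum R D₁ D₂ θ u' v := by
  unfold f3sum
  refine Finset.sum_congr rfl fun q hq => ?_
  simp only [f3term, h _ (Finset.mem_powerset.2 (f3S1_subset hq))]

/-- `f3sum` depends on `v` only through its values on `P(D₁ ∪ D₂)`. -/
theorem f3sum_congr_right (D₁ D₂ : Finset κ) (θ : ℕ) (u : Finset κ → R) {v v' : Finset κ → R}
    (h : ∀ S ∈ (D₁ ∪ D₂).powerset, v S = v' S) : f3sum R D₁ D₂ θ u v = f3sum R D₁ D₂ θ u v' := by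
  unfold f3sum
  refine Finset.sum_congr rfl fun q hq => ?_
  simp only [f3term, h _ (Finset.mem_powerset.2 (f3S1_subset hq)), h _ (Finset.mem_powerset.2 (f3S2_subset hq))]

/-! ## The cone lemma: a linear local functional nonnegative on upper-set indicators is nonnegative on monotone nonnegative functions -/

/-- **Cone lemma.** On the finite Boolean lattice `P(D)`, a functional `Φ` of functions `Finset κ → ℝ` that is additive, homogeneous and depends only on
the values on `P(D)` is nonnegative at every function that is monotone and nonnegative on `P(D)` as soon as it is nonnegative at the indicator of
every upper subset of `P(D)` (the extreme rays of that cone: peel off `m · 1_{supp u}` with `m` the least positive value). [folklore] -/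
theorem nonneg_of_nonneg_on_upper_indicators (D : Finset κ) (Φ : (Finset κ → ℝ) → ℝ)
    (hadd : ∀ u w, Φ (u + w) = Φ u + Φ w) (hsmul : ∀ (c : ℝ) (u), Φ (c • u) = c * Φ u)
    (hloc : ∀ u w, (∀ S ∈ D.powerset, u S = w S) → Φ u = Φ w)
    (hind : ∀ U : Finset (Finset κ), U ⊆ D.powerset → (∀ S ∈ U, ∀ T ∈ D.powerset, S ⊆ T → T ∈ U) →
      0 ≤ Φ (fun S => if S ∈ U then 1 else 0))
    (u : Finset κ → ℝ) (hmono : ∀ S ∈ D.powerset, ∀ T ∈ D.powerset, S ⊆ T → u S ≤ u T) (hnn : ∀ S ∈ D.powerset, 0 ≤ u S) :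
    0 ≤ Φ u := by
  have h0 : Φ 0 = 0 := by simpa using hsmul 0 0
  -- strong induction on the size of the support inside `P(D)`
  suffices key : ∀ n : ℕ, ∀ u : Finset κ → ℝ, (D.powerset.filter (fun S => 0 < u S)).card ≤ n →
      (∀ S ∈ D.powerset, ∀ T ∈ D.powerset, S ⊆ T → u S ≤ u T) → (∀ S ∈ D.powerset, 0 ≤ u S) → 0 ≤ Φ u from
    key _ u le_rfl hmono hnn
  intro n
  induction n with
  | zero =>
    intro u hcard _ hnn
    have hsupp : D.powerset.filter (fun S => 0 < u S) = ∅ := Finset.card_eq_zero.1 (Nat.le_zero.1 hcard)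
    have hz : ∀ S ∈ D.powerset, u S = (0 : Finset κ → ℝ) S := by
      intro S hS
      have : ¬ 0 < u S := fun hpos => by
        have : S ∈ D.powerset.filter (fun S => 0 < u S) := Finset.mem_filter.2 ⟨hS, hpos⟩
        rw [hsupp] at this; simp at this
      exact le_antisymm (not_lt.1 this) (hnn S hS)
    rw [hloc u 0 hz, h0]
  | succ n ih =>
    intro u hcard hmono hnn
    set supp := D.powerset.filter (fun S => 0 < u S) with hsupp_def
    by_cases hne : supp.Nonempty
    · -- the least positive value
      set m := supp.inf' hne u with hm_def
      obtain ⟨Smin, hSmin, hSmin_eq⟩ := Finset.exists_mem_eq_inf' hne u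
      have hm_pos : 0 < m := by rw [hm_def, hSmin_eq]; exact (Finset.mem_filter.1 hSmin).2
      have hm_le : ∀ S ∈ supp, m ≤ u S := fun S hS => Finset.inf'_le u hS
      have hsuppP : supp ⊆ D.powerset := Finset.filter_subset _ _
      have hsupp_up : ∀ S ∈ supp, ∀ T ∈ D.powerset, S ⊆ T → T ∈ supp := by
        intro S hS T hT hST
        have hS' := Finset.mem_filter.1 hS
        exact Finset.mem_filter.2 ⟨hT, lt_of_lt_of_le hS'.2 (hmono S hS'.1 T hT hST)⟩
      -- peel
      set w : Finset κ → ℝ := fun S => u S - m * (if S ∈ supp then 1 else 0) with hw_def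
      have hu_eq : u = w + m • (fun S => if S ∈ supp then (1 : ℝ) else 0) := by
        funext S; simp only [hw_def, Pi.add_apply, Pi.smul_apply, smul_eq_mul]; ring
      have hw_nn : ∀ S ∈ D.powerset, 0 ≤ w S := by
        intro S hS
        by_cases hSs : S ∈ supp
        · simp only [hw_def, hSs, if_true, mul_one, sub_nonneg]; exact hm_le S hSs
        · simp only [hw_def, hSs, if_false, mul_zero, sub_zero]; exact hnn S hS
      have hu_zero : ∀ S ∈ D.powerset, S ∉ supp → u S = 0 := by
        intro S hS hSs
        have : ¬ 0 < u S := fun hpos => hSs (Finset.mem_filter.2 ⟨hS, hpos⟩)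
        exact le_antisymm (not_lt.1 this) (hnn S hS)
      have hw_mono : ∀ S ∈ D.powerset, ∀ T ∈ D.powerset, S ⊆ T → w S ≤ w T := by
        intro S hS T hT hST
        by_cases hTs : T ∈ supp
        · by_cases hSs : S ∈ supp
          · simp only [hw_def, hSs, hTs, if_true, mul_one]; linarith [hmono S hS T hT hST]
          · simp only [hw_def, hSs, hTs, if_true, if_false, mul_one, mul_zero, sub_zero]
            rw [hu_zero S hS hSs]; linarith [hm_le T hTs]
        · have hSs : S ∉ supp := fun hSs => hTs (hsupp_up S hSs T hT hST)
          simp only [hw_def, hSs, hTs, if_false, mul_zero, sub_zero]; exact hmono S hS T hT hST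
      have hw_card : (D.powerset.filter (fun S => 0 < w S)).card ≤ n := by
        have hsub : D.powerset.filter (fun S => 0 < w S) ⊂ supp := by
          rw [Finset.ssubset_iff_subset_ne]
          refine ⟨fun S hS => ?_, fun heq => ?_⟩
          · have hS' := Finset.mem_filter.1 hS
            by_contra hSs
            have : w S = u S := by simp only [hw_def, hSs, if_false, mul_zero, sub_zero]
            rw [this, hu_zero S hS'.1 hSs] at hS'; exact lt_irrefl _ hS'.2
          · have : Smin ∈ D.powerset.filter (fun S => 0 < w S) := by rw [heq]; exact hSmin
            have h2 := (Finset.mem_filter.1 this).2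
            have hum : u Smin = m := by rw [hm_def, hSmin_eq]
            simp only [hw_def, hSmin, if_true, mul_one, hum, sub_self] at h2
            exact lt_irrefl _ h2
        have := Finset.card_lt_card hsub
        omega
      rw [hu_eq, hadd, hsmul]
      have h1 := ih w hw_card hw_mono hw_nn
      have h2 := hind supp hsuppP hsupp_up
      positivity
    · -- empty support: `u = 0` on `P(D)`
      rw [Finset.not_nonempty_iff_eq_empty] at hne
      have hz : ∀ S ∈ D.powerset, u S = (0 : Finset κ → ℝ) S := by
        intro S hS
        have : ¬ 0 < u S := fun hpos => by
          have : S ∈ supp := Finset.mem_filter.2 ⟨hS, hpos⟩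
          rw [hne] at this; simp at this
        exact le_antisymm (not_lt.1 this) (hnn S hS)
      rw [hloc u 0 hz, h0]

/-- **The fibre form is nonnegative on monotone nonnegative functions as soon as it is nonnegative on pairs of upper-set indicators**
(the cone lemma in each argument). [this work] -/
theorem f3sum_nonneg_of_indicators (D₁ D₂ : Finset κ) (θ : ℕ)
    (hind : ∀ U V : Finset (Finset κ), U ⊆ (D₁ ∪ D₂).powerset → (∀ S ∈ U, ∀ T ∈ (D₁ ∪ D₂).powerset, S ⊆ T → T ∈ U) →
      V ⊆ (D₁ ∪ D₂).powerset → (∀ S ∈ V, ∀ T ∈ (D₁ ∪ D₂).powerset, S ⊆ T → T ∈ V) →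
      0 ≤ f3sum ℝ D₁ D₂ θ (fun S => if S ∈ U then 1 else 0) (fun S => if S ∈ V then 1 else 0))
    (u v : Finset κ → ℝ) (hu : ∀ S ∈ (D₁ ∪ D₂).powerset, ∀ T ∈ (D₁ ∪ D₂).powerset, S ⊆ T → u S ≤ u T)
    (hu0 : ∀ S ∈ (D₁ ∪ D₂).powerset, 0 ≤ u S)
    (hv : ∀ S ∈ (D₁ ∪ D₂).powerset, ∀ T ∈ (D₁ ∪ D₂).powerset, S ⊆ T → v S ≤ v T) (hv0 : ∀ S ∈ (D₁ ∪ D₂).powerset, 0 ≤ v S) :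
    0 ≤ f3sum ℝ D₁ D₂ θ u v := by
  refine nonneg_of_nonneg_on_upper_indicators (D₁ ∪ D₂) (fun u => f3sum ℝ D₁ D₂ θ u v) (fun u w => f3sum_add_left D₁ D₂ θ u w v)
    (fun c u => f3sum_smul_left D₁ D₂ θ c u v) (fun u w h => f3sum_congr_left D₁ D₂ θ v h) (fun U hU hUup => ?_) u hu hu0
  exact nonneg_of_nonneg_on_upper_indicators (D₁ ∪ D₂) (fun v => f3sum ℝ D₁ D₂ θ (fun S => if S ∈ U then 1 else 0) v)
    (fun v w => f3sum_add_right D₁ D₂ θ _ v w) (fun c v => f3sum_smul_right D₁ D₂ θ c _ v)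
    (fun v w h => f3sum_congr_right D₁ D₂ θ _ h) (fun V hV hVup => hind U V hU hUup hV hVup) v hv hv0

end Generic

/-! ## The threshold slot: `(2′)` reduces to the fibre forms -/

variable {ι : Type*} [Fintype ι] [DecidableEq ι]

omit [Fintype ι] in
/-- **The three-copy summand of a threshold slot** on the fibre `(I₃, I₂, J)` at the quadruple `q` is the `f3term` of the threshold trace
`[t − |I₃| ≤ |·|]` with `u = 1_A(I₃ ∪ ·)`, `v = 1_B(I₃ ∪ ·)`. [this work] -/
theorem phi3_threshold_eq (F : Finset ι) (t : ℕ) (A B : Set (Set ι)) {I₃ I₂ J : Finset ι} (h32 : I₃ ⊆ I₂) (h2J : I₂ ⊆ J) (hJF : J ⊆ F)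
    {q : (Finset ι × Finset ι) × (Finset ι × Finset ι)} (hq : q ∈ f3quads (J \ I₂) (I₂ \ I₃)) :
    phi3 {ω : Set ι | t ≤ (F.filter (· ∈ ω)).card} A B (I₃ ∪ ((I₂ \ I₃) \ q.2.1) ∪ q.1.1) (I₃ ∪ ((I₂ \ I₃) \ q.2.2) ∪ q.1.2)
        (I₃ ∪ (q.2.1 ∪ q.2.2) ∪ ((J \ I₂) \ (q.1.1 ∪ q.1.2))) =
      f3term ℝ (J \ I₂) (I₂ \ I₃) (t - I₃.card) (fun S => ind (pat A) (I₃ ∪ S)) (fun S => ind (pat B) (I₃ ∪ S)) q := by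
  have h3J : I₃ ⊆ J := h32.trans h2J
  have hD : (J \ I₂) ∪ (I₂ \ I₃) ⊆ J \ I₃ := by
    intro i hi
    simp only [Finset.mem_union, Finset.mem_sdiff] at hi ⊢
    rcases hi with ⟨hj, hi2⟩ | ⟨hi2, hi3⟩
    · exact ⟨hj, fun hi3 => hi2 (h32 hi3)⟩
    · exact ⟨h2J hi2, hi3⟩
  have e0 : I₃ ∪ ((I₂ \ I₃) \ q.2.1) ∪ q.1.1 = I₃ ∪ f3S0 (I₂ \ I₃) q := by rw [f3S0, Finset.union_assoc]
  have e1 : I₃ ∪ ((I₂ \ I₃) \ q.2.2) ∪ q.1.2 = I₃ ∪ f3S1 (I₂ \ I₃) q := by rw [f3S1, Finset.union_assoc]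
  have e2 : I₃ ∪ (q.2.1 ∪ q.2.2) ∪ ((J \ I₂) \ (q.1.1 ∪ q.1.2)) = I₃ ∪ f3S2 (J \ I₂) q := by rw [f3S2, Finset.union_assoc]
  rw [e0, e1, e2]
  unfold phi3 f3term thrR
  simp only [ind_pat_inter]
  rw [ind_pat_threshold_union F t h3J hJF ((f3S0_subset hq).trans hD), ind_pat_threshold_union F t h3J hJF ((f3S1_subset hq).trans hD),
    ind_pat_threshold_union F t h3J hJF ((f3S2_subset hq).trans hD)]

omit [Fintype ι] in
/-- Monotone and nonnegative pattern indicators of an increasing event, in the relative form used by the cone lemma. -/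
theorem ind_pat_union_mono_on {A : Set (Set ι)} (hA : IsUpperSet A) (I D : Finset ι) :
    (∀ S ∈ D.powerset, ∀ T ∈ D.powerset, S ⊆ T → ind (pat A) (I ∪ S) ≤ ind (pat A) (I ∪ T)) ∧
      ∀ S ∈ D.powerset, (0 : ℝ) ≤ ind (pat A) (I ∪ S) :=
  ⟨fun _ _ _ _ h => ind_pat_union_mono hA I h, fun _ _ => ind_nonneg _ _⟩

/-- **`(2′)` for a threshold slot from the fibre forms.**  If the three-copy fibre form `f3sum` of every threshold trace on at most `|F|` free coordinates is
nonnegative on pairs of upper-set indicators, then `n ≥ 0` for `H = Th_t(F)` and all increasing `F`-determined `A, B`. [this work] -/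
theorem osN_threshold_nonneg_of_f3 (p : ι → unitInterval) (F : Finset ι) (t : ℕ) {A B : Set (Set ι)}
    (hA : IsUpperSet A) (hB : IsUpperSet B) (hAF : DeterminedBy A (↑F : Set ι)) (hBF : DeterminedBy B (↑F : Set ι))
    (hf3 : ∀ D₁ D₂ : Finset ι, D₁ ∪ D₂ ⊆ F → Disjoint D₁ D₂ → ∀ θ : ℕ, ∀ U V : Finset (Finset ι),
      U ⊆ (D₁ ∪ D₂).powerset → (∀ S ∈ U, ∀ T ∈ (D₁ ∪ D₂).powerset, S ⊆ T → T ∈ U) →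
      V ⊆ (D₁ ∪ D₂).powerset → (∀ S ∈ V, ∀ T ∈ (D₁ ∪ D₂).powerset, S ⊆ T → T ∈ V) →
      0 ≤ f3sum ℝ D₁ D₂ θ (fun S => if S ∈ U then 1 else 0) (fun S => if S ∈ V then 1 else 0)) :
    0 ≤ osN p {ω : Set ι | t ≤ (F.filter (· ∈ ω)).card} (ind A) (ind B) := by
  refine osN_ind_ind_nonneg_of_fibre3' p (determinedBy_threshold F t) hAF hBF fun I₃ I₂ J h32 h2J hJF => ?_
  have hquads : ((((J \ I₂).powerset ×ˢ (J \ I₂).powerset) ×ˢ ((I₂ \ I₃).powerset ×ˢ (I₂ \ I₃).powerset)).filter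
      (fun q => Disjoint q.1.1 q.1.2 ∧ Disjoint q.2.1 q.2.2)) = f3quads (J \ I₂) (I₂ \ I₃) := rfl
  rw [hquads, Finset.sum_congr rfl fun q hq => phi3_threshold_eq F t A B h32 h2J hJF hq]
  change 0 ≤ f3sum ℝ (J \ I₂) (I₂ \ I₃) (t - I₃.card) (fun S => ind (pat A) (I₃ ∪ S)) (fun S => ind (pat B) (I₃ ∪ S))
  have hDF : (J \ I₂) ∪ (I₂ \ I₃) ⊆ F := by
    intro i hi
    simp only [Finset.mem_union, Finset.mem_sdiff] at hi
    rcases hi with ⟨hj, _⟩ | ⟨hi2, _⟩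
    · exact hJF hj
    · exact hJF (h2J hi2)
  have hdisj : Disjoint (J \ I₂) (I₂ \ I₃) := Finset.disjoint_left.2 fun i hi hi' => (Finset.mem_sdiff.1 hi).2 (Finset.mem_sdiff.1 hi').1
  obtain ⟨huA, huA0⟩ := ind_pat_union_mono_on hA I₃ ((J \ I₂) ∪ (I₂ \ I₃))
  obtain ⟨hvB, hvB0⟩ := ind_pat_union_mono_on hB I₃ ((J \ I₂) ∪ (I₂ \ I₃))
  exact f3sum_nonneg_of_indicators (J \ I₂) (I₂ \ I₃) (t - I₃.card) (hf3 _ _ hDF hdisj _) _ _ huA huA0 hvB hvB0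

end SahiOneStep

end Summit.CriticalPhenomena.PercolationContinuityZ3.Theorems
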